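import Summits.QuantumFields.YangMills.Theorems.UnitScaleGibbsThinRectanglePerimeterGibbs
import Literature.MathematicalPhysics.QuantumFieldTheory.LatticeGaugeStringTensionProofs
import HarnessLib

/-!
# Thin rectangles under `gibbsMeasure P β`: measurability, degenerate sides, the `(0 1)` coordinate swap, and the
# length-uniform perimeter bound in the mean PLAQUETTE

Cell `ym3-torus` (HUMAN RULING D-0037, rung R3), width seat `ym3-torus-px5` gen 10; FILE 5 of the (THIN-RECT) lane (measure-side
letters for `stub_thinRect`, LINE 28 v3 draft).  On Bałaban's finest torus `T^{(0)}` (`GaugeField P 0 SU(N)`,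
`T4GenFunBounds.gibbsMeasure P β`, `β ≥ 0`), rectangles being the host `rectangleHolonomy (toConfig U) x i j R T`:

* §1 `measurable_lineHolonomy`, `measurable_rectangleHolonomy(_toConfig)`, `integrable_dist1_sq_rect`,
  `reTr_rectangleHolonomy_one_one_eq_plaqHol` (the `1 × 1` rectangle is the plaquette `U(∂p)`);
* §2 `integral_comp_swap_gibbsMeasure`: the law of `toConfig U` is invariant under the transposition of the coordinates `0, 1`
  (host ✓`StringTension.wilsonExpectation_comp_swap` through ✓`GibbsMeasureWilsonDictionary`); hence
  `gibbs_integral_dist1_sq_rect_swap`: `∫ dist1(U(x∘σ; σi, σj; R×T))² = ∫ dist1(U(x; i, j; R×T))²`;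
* §3 `gibbs_integral_dist1_sq_thinRect_le_plaq`: for `j ≠ 0`, `n ≤ n₀`, `2n₀ + 4 ≤ sitesPerDir 0`, every base point,
  `∫ dist1(U(x; 0, j; n×1))² dμ_β ≤ 8N·n₀·∫ (1 − reTr U(∂p₀ⱼ)) dμ_β` (`p₀ⱼ` the plaquette at the origin of the `(0,j)` plane; FILE 2
  ✓`gibbs_integral_dist1_sq_thinRect_le` for `n ≥ 1`, trivial for `n = 0`), and the same for rectangles long in direction `1`
  (`gibbs_integral_dist1_sq_thinRect_one_le_plaq`, by §2).

Everything here is proved; no definitions.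
-/

open MeasureTheory
open scoped Matrix.Norms.L2Operator

namespace Summit.QuantumFields.YangMills.Theorems.UnitScaleGibbsThinRectangleSwap

open Literature.MathematicalPhysics.QuantumFieldTheory
open Literature.MathematicalPhysics.QuantumFieldTheory.Balaban1983to89
open Literature.MathematicalPhysics.QuantumLattice (fundamentalRep continuous_fundamentalRep fundamentalRep_mem_unitaryGroup)
open Summit.QuantumFields.YangMills.Theorems.UnitScaleGibbsThinRectanglePerimeter
open Summit.QuantumFields.YangMills.Theorems.UnitScaleGibbsThinRectanglePerimeterGibbs

noncomputable section

/-! ## §1 Measurability and degenerate rectangles (host carrier, any group) -/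

section Host

variable {d L : ℕ} {G : Type*} [Group G]

variable [MeasurableSpace G] [MeasurableMul₂ G]

/-- Straight-line holonomies are measurable functions of the configuration. [folklore] -/
theorem measurable_lineHolonomy (k : Fin d) :
    ∀ (n : ℕ) (y : Site d L), Measurable fun V : GaugeConfig d L G => lineHolonomy V k n y
  | 0, y => by
    show Measurable fun V : GaugeConfig d L G => (1 : G)
    exact measurable_const
  | n + 1, y => by
    show Measurable fun V : GaugeConfig d L G => V (y, k) * lineHolonomy V k n (y.shift k)
    exact (measurable_pi_apply (y, k)).mul (measurable_lineHolonomy k n (y.shift k))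

/-- Rectangle holonomies are measurable functions of the configuration. [folklore] -/
theorem measurable_rectangleHolonomy [MeasurableInv G] (x : Site d L) (i j : Fin d) (R T : ℕ) :
    Measurable fun V : GaugeConfig d L G => rectangleHolonomy V x i j R T := by
  unfold rectangleHolonomy
  exact (((measurable_lineHolonomy i R x).mul (measurable_lineHolonomy j T _)).mul
    (measurable_lineHolonomy i R _).inv).mul (measurable_lineHolonomy j T x).inv

end Host

/-! ## §1' The same read on Bałaban's torus -/

section Balaban

variable {N : ℕ} [NeZero N] (P : Params)

/-- Rectangle holonomies of `toConfig U` are measurable in `U`. [folklore] -/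
theorem measurable_rectangleHolonomy_toConfig (x : Site P.d (P.sitesPerDir 0)) (i j : Fin P.d) (R T : ℕ) :
    Measurable fun U : GaugeField P 0 (Matrix.specialUnitaryGroup (Fin N) ℂ) => rectangleHolonomy (toConfig U) x i j R T :=
  (measurable_rectangleHolonomy x i j R T).comp measurable_toConfig

/-- `dist1(rect)²` is integrable under `gibbsMeasure P β` (bounded by `(1 + 1)²`, measurable). [folklore] -/
theorem integrable_dist1_sq_rect {β : ℝ} (hβ : 0 ≤ β) (x : Site P.d (P.sitesPerDir 0)) (i j : Fin P.d) (R T : ℕ) :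
    Integrable (fun U : GaugeField P 0 (Matrix.specialUnitaryGroup (Fin N) ℂ) =>
      dist1 (rectangleHolonomy (toConfig U) x i j R T) ^ 2) (T4GenFunBounds.gibbsMeasure P β) := by
  haveI := T4GenFunBounds.isProbabilityMeasure_gibbsMeasure (G := Matrix.specialUnitaryGroup (Fin N) ℂ) P hβ
  have hm : Measurable fun U : GaugeField P 0 (Matrix.specialUnitaryGroup (Fin N) ℂ) =>
      dist1 (rectangleHolonomy (toConfig U) x i j R T) ^ 2 :=
    (RegularGaugeGroup.measurable_dist1.comp (measurable_rectangleHolonomy_toConfig P x i j R T)).pow_const 2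
  refine (integrable_const ((1 + 1) ^ 2 : ℝ)).mono' hm.aestronglyMeasurable (ae_of_all _ fun U => ?_)
  rw [Real.norm_eq_abs, abs_of_nonneg (sq_nonneg _)]
  have h1 : dist1 (rectangleHolonomy (toConfig U) x i j R T) ≤ 1 + 1 := by
    rw [dist1_rectangleHolonomy_eq]
    exact (norm_sub_le _ _).trans (by rw [UnitaryModel.norm_of_mem_unitaryGroup (fundamentalRep_mem_unitaryGroup _), norm_one])
  exact pow_le_pow_left₀ (GaugeGroup.dist1_nonneg _) h1 2

/-- The `1 × 1` rectangle at the origin of the `(i, j)` plane, `i < j`, is the plaquette variable `U(∂p)`, `p = ⟨0, i, j⟩`. [folklore] -/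
theorem reTr_rectangleHolonomy_one_one_eq_plaqHol (U : GaugeField P 0 (Matrix.specialUnitaryGroup (Fin N) ℂ))
    (x : Site P.d (P.sitesPerDir 0)) {i j : Fin P.d} (hij : i < j) :
    rectangleHolonomy (toConfig U) x i j 1 1 = GaugeField.plaqHol U ⟨x, i, j, hij⟩ := by
  -- the `1 × 1` rectangle is the plaquette (also ✓`RobustYangMills.Negative.rectangleHolonomy_one_one` in another summit)
  rw [← plaquetteHolonomy_toConfig]
  simp only [rectangleHolonomy, lineHolonomy, plaquetteHolonomy, mul_one, Nat.cast_one]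
  rfl

/-! ## §2 The coordinate swap `(0 1)` -/

/-- **The law of `toConfig U` under `gibbsMeasure P β` is invariant under the transposition of the coordinates `0` and `1`**
(host ✓`StringTension.wilsonExpectation_comp_swap` read through the dictionary). [folklore] -/
theorem integral_comp_swap_gibbsMeasure {β : ℝ} (hβ : 0 ≤ β)
    (F : GaugeConfig P.d (P.sitesPerDir 0) (Matrix.specialUnitaryGroup (Fin N) ℂ) → ℝ) :
    ∫ U : GaugeField P 0 (Matrix.specialUnitaryGroup (Fin N) ℂ),
        F (fun e : Edge P.d (P.sitesPerDir 0) =>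
          toConfig U ((fun k' => e.1 (Equiv.swap (0 : Fin P.d) 1 k')), Equiv.swap (0 : Fin P.d) 1 e.2))
        ∂(T4GenFunBounds.gibbsMeasure P β) =
      ∫ U : GaugeField P 0 (Matrix.specialUnitaryGroup (Fin N) ℂ), F (toConfig U) ∂(T4GenFunBounds.gibbsMeasure P β) := by
  rw [GibbsMeasureWilsonDictionary.integral_gibbsMeasure_eq_integral_wilsonMeasure P hβ,
    GibbsMeasureWilsonDictionary.integral_gibbsMeasure_eq_integral_wilsonMeasure P hβ]
  simp only [toConfig_ofConfig]
  exact StringTension.wilsonExpectation_comp_swap (fundamentalRep (Fin N)) (continuous_fundamentalRep (Fin N)) (β / N) F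

/-- **Swapped rectangles have the same second moment**: `∫ dist1(U(x∘σ; σ i, σ j; R × T))² dμ_β = ∫ dist1(U(x; i, j; R × T))² dμ_β`,
`σ = (0 1)`. [folklore] -/
theorem gibbs_integral_dist1_sq_rect_swap {β : ℝ} (hβ : 0 ≤ β) (x : Site P.d (P.sitesPerDir 0)) (i j : Fin P.d) (R T : ℕ) :
    ∫ U : GaugeField P 0 (Matrix.specialUnitaryGroup (Fin N) ℂ),
        dist1 (rectangleHolonomy (toConfig U) (fun k' => x (Equiv.swap (0 : Fin P.d) 1 k')) (Equiv.swap (0 : Fin P.d) 1 i)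
          (Equiv.swap (0 : Fin P.d) 1 j) R T) ^ 2 ∂(T4GenFunBounds.gibbsMeasure P β) =
      ∫ U : GaugeField P 0 (Matrix.specialUnitaryGroup (Fin N) ℂ),
        dist1 (rectangleHolonomy (toConfig U) x i j R T) ^ 2 ∂(T4GenFunBounds.gibbsMeasure P β) := by
  have h := integral_comp_swap_gibbsMeasure (N := N) P hβ
    (fun V => dist1 (rectangleHolonomy V x i j R T) ^ 2)
  simp only [StringTension.rectangleHolonomy_swap] at h
  exact h

/-! ## §3 The length-uniform perimeter bound in the mean plaquette -/

/-- **Length-uniform thin-rectangle bound, direction `0`**: for `β ≥ 0`, `0 < j`, `n ≤ n₀`, `2n₀ + 4 ≤ sitesPerDir 0` and every base point,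
`∫ dist1(U(x; 0, j; n × 1))² dμ_β ≤ 8N·n₀·∫ (1 − reTr U(∂p₀ⱼ)) dμ_β` (FILE 2 for `n ≥ 1`, `2N(4n − 3) ≤ 8N n₀`; `n = 0` is trivial).
[cite: SeilerLNP1982, §2 (static quark potential and string tension from reflection positivity)] -/
theorem gibbs_integral_dist1_sq_thinRect_le_plaq {β : ℝ} (hβ : 0 ≤ β) {j : Fin P.d} (hj : 0 < j) {n n₀ : ℕ} (hn : n ≤ n₀)
    (hn₀ : 2 * n₀ + 4 ≤ P.sitesPerDir 0) (x : Site P.d (P.sitesPerDir 0)) :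
    ∫ U : GaugeField P 0 (Matrix.specialUnitaryGroup (Fin N) ℂ),
        dist1 (rectangleHolonomy (toConfig U) x 0 j n 1) ^ 2 ∂(T4GenFunBounds.gibbsMeasure P β) ≤
      8 * N * n₀ * ∫ U : GaugeField P 0 (Matrix.specialUnitaryGroup (Fin N) ℂ),
        (1 - reTr (GaugeField.plaqHol U ⟨(0 : Literature.MathematicalPhysics.QuantumFieldTheory.Site P.d (P.sitesPerDir 0)), 0, j, hj⟩))
          ∂(T4GenFunBounds.gibbsMeasure P β) := by
  haveI := T4GenFunBounds.isProbabilityMeasure_gibbsMeasure (G := Matrix.specialUnitaryGroup (Fin N) ℂ) P hβ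
  have hplaq : 0 ≤ ∫ U : GaugeField P 0 (Matrix.specialUnitaryGroup (Fin N) ℂ),
      (1 - reTr (GaugeField.plaqHol U ⟨(0 : Literature.MathematicalPhysics.QuantumFieldTheory.Site P.d (P.sitesPerDir 0)), 0, j, hj⟩))
          ∂(T4GenFunBounds.gibbsMeasure P β) :=
    integral_nonneg fun U => sub_nonneg.2 (GaugeGroup.reTr_le_one _)
  rcases Nat.eq_zero_or_pos n with rfl | hn1
  · -- `R = 0`: the rectangle is trivial (also ✓`GaugeBoot.rectangleHolonomy_height_zero` in another summit)
    have h0 : ∀ U : GaugeField P 0 (Matrix.specialUnitaryGroup (Fin N) ℂ), rectangleHolonomy (toConfig U) x 0 j 0 1 = 1 :=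
      fun U => by simp [rectangleHolonomy, lineHolonomy]
    simp only [h0, GaugeGroup.dist1_one]
    rw [zero_pow two_ne_zero, integral_zero]
    positivity
  · have h := gibbs_integral_dist1_sq_thinRect_le (N := N) P hβ hj.ne' hn1 (by omega) 1 x
    have hpl : ∀ U : GaugeField P 0 (Matrix.specialUnitaryGroup (Fin N) ℂ),
        rectangleHolonomy (toConfig U) (0 : Literature.MathematicalPhysics.QuantumFieldTheory.Site P.d (P.sitesPerDir 0)) 0 j 1 1 =
          GaugeField.plaqHol U ⟨(0 : Literature.MathematicalPhysics.QuantumFieldTheory.Site P.d (P.sitesPerDir 0)), 0, j, hj⟩ :=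
      fun U => reTr_rectangleHolonomy_one_one_eq_plaqHol P U _ hj
    simp only [hpl] at h
    refine h.trans ?_
    have h43 : (2 * N * (4 * n - 3 : ℝ)) ≤ 8 * N * n₀ := by
      have : (n : ℝ) ≤ n₀ := by exact_mod_cast hn
      have hN : (0 : ℝ) ≤ N := Nat.cast_nonneg _
      nlinarith
    exact mul_le_mul_of_nonneg_right h43 hplaq

/-- **Length-uniform thin-rectangle bound, direction `1`** (`2 ≤ d`): for a rectangle long in direction `1` and of width one in a direction
`j ∉ {0, 1}`, the same bound with the plaquette `p₀ⱼ` of the `(0, j)` plane — the coordinate swap `(0 1)` of §2 followed by the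
direction-`0` bound. [cite: SeilerLNP1982, §2 (static quark potential and string tension from reflection positivity)] -/
theorem gibbs_integral_dist1_sq_thinRect_one_le_plaq {β : ℝ} (hβ : 0 ≤ β) {j : Fin P.d} (hj : 0 < j) (hj1 : j ≠ 1) {n n₀ : ℕ}
    (hn : n ≤ n₀) (hn₀ : 2 * n₀ + 4 ≤ P.sitesPerDir 0) (x : Site P.d (P.sitesPerDir 0)) :
    ∫ U : GaugeField P 0 (Matrix.specialUnitaryGroup (Fin N) ℂ),
        dist1 (rectangleHolonomy (toConfig U) x 1 j n 1) ^ 2 ∂(T4GenFunBounds.gibbsMeasure P β) ≤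
      8 * N * n₀ * ∫ U : GaugeField P 0 (Matrix.specialUnitaryGroup (Fin N) ℂ),
        (1 - reTr (GaugeField.plaqHol U ⟨(0 : Literature.MathematicalPhysics.QuantumFieldTheory.Site P.d (P.sitesPerDir 0)), 0, j, hj⟩))
          ∂(T4GenFunBounds.gibbsMeasure P β) := by
  have hswap := gibbs_integral_dist1_sq_rect_swap (N := N) P hβ (fun k' => x (Equiv.swap (0 : Fin P.d) 1 k')) 0 j n 1
  have hx : (fun k' => (fun k'' => x (Equiv.swap (0 : Fin P.d) 1 k'')) (Equiv.swap (0 : Fin P.d) 1 k')) = x := by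
    funext k'; simp [Equiv.swap_apply_self]
  rw [hx, Equiv.swap_apply_left, Equiv.swap_apply_of_ne_of_ne hj.ne' hj1] at hswap
  exact hswap.trans_le (gibbs_integral_dist1_sq_thinRect_le_plaq P hβ hj hn hn₀ _)

end Balaban

end

end Summit.QuantumFields.YangMills.Theorems.UnitScaleGibbsThinRectangleSwap
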